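import Summits.NavierStokesRegularity.NavierStokesRegularity.Theorems.TerminalTraceTypeITraceScarL3ExtinctApexSliceBound
import HarnessLib

/-!
# Line `extinct-apex` of `TerminalTrace.TypeITraceScarL3`, Stub 2 — tool file 2/3: the time
# modulus of the zoomed pairings at the final time, uniform in the scale, under Type-I data

Route `TerminalTrace` (NavierStokesRegularity), item `TypeITraceScarL3` (stmt-NavierStokesRegularity-18385),
registered skeleton `extinct-apex` (nsreg-p2 g26, sha16 07e82d2c7e70161a), Stub 2
`stub_extinctApex_of_L3trace` (a Type-I-in-time blow-up with an `L³` terminal ball at a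
backward-singular apex zooms to an EXTINCT Type-I apex).  Seat ns-typeII-p3 g9 (cell
ns-regularity-ideate), helper file `--supports stmt-NavierStokesRegularity-18385`.

The tree proves the weak vanishing of a vertex blow-up limit at its final time in
Seregin–Šverák's ONE-SIDED-PRESSURE setting (`SereginSverak2002.zoom_slice_pairing_bound`,
`….zoom_pairing_modulus`, `….ae_abs_pairing_le_near_top_of_scaledEnergy`); there the pressure sign
serves only to produce (i) a Morrey bound `∫_{B(x₀,ρ)} |u(t)|² ≤ M ρ` near the vertex and (ii) a
scale-invariant `L^{3/2}` bound on the pressure in the vertex cylinders.  The three files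
`…ExtinctApexSliceBound`, `…ExtinctApexPairingModulus`, `…ExtinctApexTopVanishing` re-run those
proofs with (i) and (ii) as HYPOTHESES — (ii) in the mean-free form
`cknDOsc ρ (T, x₀) p ≤ I₀` (the `D` of Albritton–Barker's `𝐈`, exactly what a local Type-I bound
at the apex supplies; `∫ p div φ` does not see the ball mean) — which is the form a Type-I blow-up
delivers (`morrey_of_typeI`, `exists_zoom_typeIBound_lt_top_of_morrey`).

This file (2/3), unit viscosity, `(u, p)` classical on `[0, T) × ℝ³` and Leray–Hopf on `[0, T]`:

* `zoom_pairing_modulus_of_morrey` — under the Morrey bound `∫_{B(x₀, ρ)} |u(t)|² ≤ M₀ ρ`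
  (`0 < ρ ≤ r₀`, `T₁ < t < T`) and the mean-free pressure bound `cknDOsc ρ (T, x₀) p ≤ I₀`
  (`0 < ρ ≤ ρ₀`), for `φ ∈ C_c^∞(B(0, a))`, `a ≥ 1`, there are `C ≥ 0`, `R₀ > 0` with
  `|∫ ⟪u_R(s), φ⟫ − ∫ ⟪u_R(0), φ⟫| ≤ C (|s| + |s|^{1/3})` for `0 < R ≤ R₀`, `s ∈ (−1, 0)`,
  `u_R(s, y) = R u(T + R² s, x₀ + R y)` (pairing identity with pressure for the zoomed classical
  solution, the slice bound of file 1/3, Hölder in the pressure through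
  `SereginSverak2002.zoom_pressure_bound`, and the weak `L²` continuity of `u` at `T`).

WHAT THIS IS NOT: not NS regularity, not item 18385, not Stub 3 — bookkeeping of
Seregin–Šverák 2002 §4 under Type-I data.  [folklore; cf. SereginSverak2002 §4]
-/

noncomputable section

set_option linter.dupNamespace false

open MeasureTheory TopologicalSpace Set Function Filter Topology Metric InnerProductSpace Real
open scoped ENNReal NNReal RealInnerProductSpace ContDiff Laplacian

namespace Summit.NavierStokesRegularity.NavierStokesRegularity.Theorems.TypeITraceScarL3

open Literature.Analysis Literature.Analysis.FluidPDE Literature.Analysis.FluidPDE.SereginSverak2002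

variable {T : ℝ} {u : ℝ → EuclideanSpace ℝ (Fin 3) → EuclideanSpace ℝ (Fin 3)}
  {p : ℝ → EuclideanSpace ℝ (Fin 3) → ℝ}

/-! ### The uniform time modulus under a Morrey bound and a mean-free pressure bound -/

set_option maxHeartbeats 3200000 in
/-- **The uniform time modulus of the zoomed pairings, Type-I form.**  Let `(u, p)` be classical on
`[0, T) × ℝ³` (`ν = 1`) and Leray–Hopf on `[0, T]`; suppose the MORREY bound
`∫_{B(x₀, ρ)} |u(t)|² ≤ M₀ ρ` for `0 < ρ ≤ r₀`, `T₁ < t < T`, and the mean-free pressure bound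
`D_osc(Q_ρ(T, x₀); p) ≤ I₀` for `0 < ρ ≤ ρ₀` at the vertex `(T, x₀)`.  Then for a test field
`φ ∈ C_c^∞(B(0, a))`, `a ≥ 1`, there are `C ≥ 0` and `R₀ > 0` such that the zooms
`u_R(s, y) = R u(T + R² s, x₀ + R y)` satisfy
`|∫ ⟪u_R(s), φ⟫ − ∫ ⟪u_R(0), φ⟫| ≤ C (|s| + |s|^{1/3})` for `0 < R ≤ R₀`, `s ∈ (−1, 0)`.
The proof is that of `SereginSverak2002.zoom_pairing_modulus` (pairing identity with pressure for
the zoomed classical solution, slice bound, Hölder in the pressure, weak `L²` continuity of `u` at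
`T`), with the Morrey and pressure bounds taken as hypotheses. [folklore; cf. SereginSverak2002 §4] -/
theorem zoom_pairing_modulus_of_morrey (hT : 0 < T)
    (hsol : IsClassicalNSSolutionOn (Ico 0 T) 1 0 u p) (hLH : IsLerayHopfOn T 1 0 (u 0) u)
    (x₀ : EuclideanSpace ℝ (Fin 3)) {r₀ M₀ T₁ : ℝ} (hr₀ : 0 < r₀) (hT₁ : T₁ < T)
    (hMor : ∀ t ∈ Ioo T₁ T, ∀ ρ : ℝ, 0 < ρ → ρ ≤ r₀ → ∫ x in ball x₀ ρ, ‖u t x‖ ^ 2 ≤ M₀ * ρ)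
    {ρ₀ : ℝ} {I₀ : ℝ≥0} (hρ₀ : 0 < ρ₀)
    (hD : ∀ ρ : ℝ, 0 < ρ → ρ ≤ ρ₀ → cknDOsc ρ ((T : ℝ), x₀) p ≤ I₀)
    {φ : EuclideanSpace ℝ (Fin 3) → EuclideanSpace ℝ (Fin 3)}
    (hφ : ContDiff ℝ ∞ φ) (hφc : HasCompactSupport φ) {a : ℝ} (ha : 1 ≤ a)
    (hφa : tsupport φ ⊆ ball (0 : EuclideanSpace ℝ (Fin 3)) a) :
    ∃ C : ℝ, 0 ≤ C ∧ ∃ R₀ > 0, ∀ R, 0 < R → R ≤ R₀ → ∀ s ∈ Ioo (-1 : ℝ) 0,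
      |(∫ y, ⟪R • u (T + R ^ 2 * s) (x₀ + R • y), φ y⟫) - ∫ y, ⟪R • u T (x₀ + R • y), φ y⟫| ≤
        C * (|s| + |s| ^ (1 / 3 : ℝ)) := by
  -- adapted from Literature/Analysis/FluidPDE/SereginSverak2002PairingModulus.lean
  -- (`SereginSverak2002.zoom_pairing_modulus`)
  have ha0 : 0 < a := by linarith
  -- the Morrey constant, nonnegative
  set MA : ℝ := max M₀ 0 with hMA
  have hMA0 : 0 ≤ MA := le_max_right _ _
  have hMor' : ∀ t ∈ Ioo T₁ T, ∀ ρ : ℝ, 0 < ρ → ρ ≤ r₀ → ∫ x in ball x₀ ρ, ‖u t x‖ ^ 2 ≤ MA * ρ :=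
    fun t ht ρ hρ hρr => (hMor t ht ρ hρ hρr).trans (mul_le_mul_of_nonneg_right (le_max_left _ _) hρ.le)
  -- the admissible radius at the vertex
  set T₁' : ℝ := max T₁ 0 with hT₁'
  have hT₁'T : T₁' < T := max_lt hT₁ hT
  have hgap : 0 < T - T₁' := sub_pos.2 hT₁'T
  set ρ₁ : ℝ := min (min ρ₀ r₀) (Real.sqrt (T - T₁') / 2) with hρ₁
  have hρ₁pos : 0 < ρ₁ := lt_min (lt_min hρ₀ hr₀) (by positivity)
  have hρ₁ρ₀ : ρ₁ ≤ ρ₀ := (min_le_left _ _).trans (min_le_left _ _)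
  have hρ₁r₀ : ρ₁ ≤ r₀ := (min_le_left _ _).trans (min_le_right _ _)
  have hρ₁sq : ρ₁ ^ 2 < T - T₁' := by
    have h1 : ρ₁ ≤ Real.sqrt (T - T₁') / 2 := min_le_right _ _
    have h2 : (Real.sqrt (T - T₁')) ^ 2 = T - T₁' := Real.sq_sqrt hgap.le
    nlinarith [Real.sqrt_nonneg (T - T₁'), Real.sqrt_pos.2 hgap]
  -- the gauged pressure is measurable on the slab (for each gauge ball)
  have hqm : ∀ r : ℝ, AEStronglyMeasurable (uncurry fun t' x => p t' x - ⨍ y' in ball x₀ r, p t' y')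
      (volume.restrict (Ioo 0 T ×ˢ (univ : Set (EuclideanSpace ℝ (Fin 3))))) :=
    fun r => aestronglyMeasurable_sub_ballMean_slab hsol x₀ r
  -- bounds of the test field
  have hφ1 : ContDiff ℝ 1 φ := contDiff_infty.1 hφ 1
  have hφ2 : ContDiff ℝ 2 φ := contDiff_infty.1 hφ 2
  obtain ⟨C₁, hC₁⟩ := (hφ.continuous_fderiv (by simp)).bounded_above_of_compact_support (hφc.fderiv ℝ)
  have hΔc : Continuous (Δ φ) := continuous_laplacian hφ2
  have hΔs : HasCompactSupport (Δ φ) :=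
    hφc.mono' fun x hx => by contrapose! hx; simp [laplacian_eq_zero_of_notMem_tsupport hx]
  obtain ⟨C₂, hC₂⟩ := hΔc.bounded_above_of_compact_support hΔs
  have hdc : Continuous fun y => VectorCalculus.divergence φ y := continuous_divergence (hφ1.continuous_fderiv one_ne_zero)
  have hds : HasCompactSupport fun y => VectorCalculus.divergence φ y := by
    refine (hφc.fderiv (𝕜 := ℝ)).mono fun y hy => ?_
    contrapose! hy
    simp only [mem_support, not_not] at hy
    simp [VectorCalculus.divergence, hy]
  obtain ⟨C₃, hC₃⟩ := hdc.bounded_above_of_compact_support hds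
  have hC₁0 : 0 ≤ C₁ := (norm_nonneg _).trans (hC₁ 0)
  have hC₂0 : 0 ≤ C₂ := (norm_nonneg _).trans (hC₂ 0)
  have hC₃0 : 0 ≤ C₃ := (norm_nonneg _).trans (hC₃ 0)
  set VB : ℝ := volume.real (ball (0 : EuclideanSpace ℝ (Fin 3)) a) with hVB
  have hVB0 : 0 ≤ VB := measureReal_nonneg
  set CH : ℝ := C₁ * (MA * a) + C₂ * ((VB + MA * a) / 2) with hCH
  have hCH0 : 0 ≤ CH := by positivity
  set K₀ : ℝ := (I₀ : ℝ) with hK₀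
  have hK₀0 : 0 ≤ K₀ := I₀.coe_nonneg
  set CP : ℝ := C₃ * ((K₀ * a ^ 2) ^ (2 / 3 : ℝ) * VB ^ (1 / 3 : ℝ)) with hCP
  have hCP0 : 0 ≤ CP := by positivity
  refine ⟨CH + CP, by positivity, ρ₁ / a, by positivity, ?_⟩
  intro R hR hRR₀ s hs
  -- basic inequalities on the scales
  have haR : a * R ≤ ρ₁ := by
    calc a * R ≤ a * (ρ₁ / a) := mul_le_mul_of_nonneg_left hRR₀ ha0.le
      _ = ρ₁ := by field_simp
  have haR0 : 0 < a * R := by positivity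
  have haRρ₀ : a * R ≤ ρ₀ := haR.trans hρ₁ρ₀
  have haRr₀ : a * R ≤ r₀ := haR.trans hρ₁r₀
  have haR2 : (a * R) ^ 2 < T - T₁' := lt_of_le_of_lt (pow_le_pow_left₀ haR0.le haR 2) hρ₁sq
  have hTT₁' : T - T₁' ≤ T := by
    have : 0 ≤ T₁' := le_max_right _ _
    linarith
  have haRT : (a * R) ^ 2 < T := lt_of_lt_of_le haR2 hTT₁'
  have hRaR : R ≤ a * R := le_mul_of_one_le_left hR.le ha
  have hR2gap : R ^ 2 < T - T₁' := lt_of_le_of_lt (pow_le_pow_left₀ hR.le hRaR 2) haR2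
  have hR2T : R ^ 2 < T := lt_of_lt_of_le hR2gap hTT₁'
  have hR2 : 0 < R ^ 2 := pow_pos hR 2
  have hs0 : 0 < |s| := abs_pos.2 hs.2.ne
  have hsabs : |s| = -s := abs_of_neg hs.2
  have hs1 : |s| < 1 := by rw [hsabs]; linarith [hs.1]
  set t : ℝ := T + R ^ 2 * s with ht
  have htT₁' : T₁' < t := by
    have h1 : R ^ 2 * (-1) < R ^ 2 * s := mul_lt_mul_of_pos_left hs.1 hR2
    simp only [ht]; linarith
  have hT₁le : T₁ ≤ T₁' := le_max_left _ _
  have ht0 : 0 < t := lt_of_le_of_lt (le_max_right _ _) htT₁'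
  have htT : t < T := by
    have h1 : R ^ 2 * s < 0 := mul_neg_of_pos_of_neg hR2 hs.2
    simp only [ht]; linarith
  have htop : t + R ^ 2 * |s| = T := by rw [ht, hsabs]; ring
  have htime : ∀ σ ∈ Icc 0 |s|, t + R ^ 2 * σ ∈ Icc 0 T := by
    intro σ hσ
    have h1 : 0 ≤ R ^ 2 * σ := mul_nonneg hR2.le hσ.1
    have h2 : R ^ 2 * σ ≤ R ^ 2 * |s| := mul_le_mul_of_nonneg_left hσ.2 hR2.le
    exact ⟨by linarith, by linarith⟩
  have htime' : ∀ σ ∈ Ioo 0 |s|, t + R ^ 2 * σ ∈ Ioo T₁' T := by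
    intro σ hσ
    have h1 : 0 < R ^ 2 * σ := mul_pos hR2 hσ.1
    have h2 : R ^ 2 * σ < R ^ 2 * |s| := mul_lt_mul_of_pos_left hσ.2 hR2
    exact ⟨by linarith, by linarith⟩
  -- the zoomed classical solution
  have hz := hsol.nsRescale_translate_zero hR t x₀
  set v : ℝ → EuclideanSpace ℝ (Fin 3) → EuclideanSpace ℝ (Fin 3) := R • stPull (R ^ 2) R t x₀ u with hv
  set pv : ℝ → EuclideanSpace ℝ (Fin 3) → ℝ := (R ^ 2) • stPull (R ^ 2) R t x₀ p with hpv
  set q : ℝ → EuclideanSpace ℝ (Fin 3) → ℝ := fun t' x => p t' x - ⨍ y' in ball x₀ (a * R), p t' y' with hq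
  set qv : ℝ → EuclideanSpace ℝ (Fin 3) → ℝ := (R ^ 2) • stPull (R ^ 2) R t x₀ q with hqv
  have hv_apply : ∀ σ y, v σ y = R • u (t + R ^ 2 * σ) (x₀ + R • y) := fun σ y => rfl
  -- the pairing function
  set g : ℝ → ℝ := fun σ => ∫ y, ⟪v σ y, φ y⟫ with hg
  have hg0 : g 0 = ∫ y, ⟪R • u (T + R ^ 2 * s) (x₀ + R • y), φ y⟫ := by
    simp only [hg, hv_apply, mul_zero, add_zero, ht]
  have hgs : g |s| = ∫ y, ⟪R • u T (x₀ + R • y), φ y⟫ := by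
    simp only [hg, hv_apply, htop]
  -- the zoomed gauged pressure: integrability and the `L¹` bound, from the mean-free `D` bound
  have hDaR : ∫⁻ z in parabolicCylinder (a * R) ((T : ℝ), x₀), ‖q z.1 z.2‖ₑ ^ (3 / 2 : ℝ) ≤
      ENNReal.ofReal (K₀ * (a * R) ^ 2) := by
    have h := hD (a * R) haR0 haRρ₀
    simp only [cknDOsc] at h
    rw [ENNReal.inv_mul_le_iff (by positivity) (ENNReal.pow_ne_top ENNReal.ofReal_ne_top)] at h
    refine (le_of_eq ?_).trans (h.trans (le_of_eq ?_))
    · rfl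
    · rw [← ENNReal.ofReal_pow haR0.le, mul_comm, ENNReal.ofReal_mul hK₀0, hK₀, ENNReal.ofReal_coe_nnreal]
  obtain ⟨hQint, hQbound⟩ := zoom_pressure_bound (q := q) (x₀ := x₀) (hqm (a * R)) ha hR hK₀0 hs haRT hDaR
  set Pf : ℝ → ℝ := fun τ => ∫ y in ball (0 : EuclideanSpace ℝ (Fin 3)) a, |qv τ y| with hPf
  have hPfint : IntegrableOn Pf (Ioo 0 |s|) := by
    have h1 : Integrable (uncurry qv) ((volume.restrict (Ioo 0 |s|)).prod
        (volume.restrict (ball (0 : EuclideanSpace ℝ (Fin 3)) a))) := by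
      rw [Measure.prod_restrict, ← Measure.volume_eq_prod]; exact hQint
    have h2 := h1.integral_norm_prod_left
    refine h2.congr (Eventually.of_forall fun τ => ?_)
    simp only [hPf, uncurry, Real.norm_eq_abs]
  have hPfnn : ∀ τ, 0 ≤ Pf τ := fun τ => integral_nonneg fun y => abs_nonneg _
  have hPftot : ∫ τ in Ioo 0 |s|, Pf τ ≤ (K₀ * a ^ 2) ^ (2 / 3 : ℝ) * (|s| * VB) ^ (1 / 3 : ℝ) := by
    have e : ∫ τ in Ioo 0 |s|, Pf τ = ∫ z in Ioo 0 |s| ×ˢ ball (0 : EuclideanSpace ℝ (Fin 3)) a, |qv z.1 z.2| := by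
      rw [Measure.volume_eq_prod, setIntegral_prod (fun z : ℝ × EuclideanSpace ℝ (Fin 3) => |qv z.1 z.2|) (by
        rw [← Measure.volume_eq_prod]
        exact hQint.norm.congr (Eventually.of_forall fun z => by
          show ‖uncurry qv z‖ = |qv z.1 z.2|
          rw [Real.norm_eq_abs]; rfl))]
    rw [e]
    exact hQbound
  -- Step A: the bound up to every `σ₂ < |s|`
  have hstepA : ∀ σ₂ ∈ Ioo 0 |s|, |g σ₂ - g 0| ≤ (CH + CP) * (|s| + |s| ^ (1 / 3 : ℝ)) := by
    intro σ₂ hσ₂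
    have hσ₂0 : 0 < σ₂ := hσ₂.1
    -- the zoomed solution on `[0, σ₂]`
    have hsub : Icc 0 σ₂ ⊆ (fun r => t + R ^ 2 * r) ⁻¹' Ico 0 T := by
      intro r hr
      have h := htime r ⟨hr.1, hr.2.trans hσ₂.2.le⟩
      have h2 : R ^ 2 * r < R ^ 2 * |s| := mul_lt_mul_of_pos_left (hr.2.trans_lt hσ₂.2) hR2
      exact ⟨h.1, by show t + R ^ 2 * r < T; linarith⟩
    have hloc := hz.mono hsub (uniqueDiffOn_Icc hσ₂0)
    have hid := hloc.integral_inner_sub_eq_pressure hσ₂0 hφ2 hφc le_rfl hσ₂0.le le_rfl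
    -- the integrand of the time integral and its bound
    have hbound : ∀ τ ∈ Ioc 0 σ₂,
        ‖((∫ y, (⟪v τ y, convect (v τ) φ y⟫ + 1 * ⟪v τ y, (Δ φ) y⟫ +
            ⟪(0 : ℝ → EuclideanSpace ℝ (Fin 3) → EuclideanSpace ℝ (Fin 3)) τ y, φ y⟫)) +
          ∫ y, pv τ y * VectorCalculus.divergence φ y)‖ ≤ CH + C₃ * Pf τ := by
      intro τ hτ
      have hθ' : t + R ^ 2 * τ ∈ Ioo T₁' T := htime' τ ⟨hτ.1, hτ.2.trans_lt hσ₂.2⟩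
      have hθ : t + R ^ 2 * τ ∈ Ico 0 T := ⟨(le_max_right T₁ 0).trans hθ'.1.le, hθ'.2⟩
      have hθ₁ : t + R ^ 2 * τ ∈ Ioo T₁ T := ⟨lt_of_le_of_lt hT₁le hθ'.1, hθ'.2⟩
      have hMθ := hMor' _ hθ₁ (a * R) haR0 haRr₀
      exact zoom_slice_pairing_bound_of_morrey hsol x₀ hφ1 hφc hφa hC₁ hC₂ hC₃ hR hθ hMθ
    -- integrate the bound in time
    have hPfI : IntervalIntegrable (fun τ => CH + C₃ * Pf τ) volume 0 σ₂ := by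
      refine (intervalIntegrable_const.add ?_)
      rw [intervalIntegrable_iff_integrableOn_Ioo_of_le hσ₂0.le]
      exact (hPfint.mono_set (Ioo_subset_Ioo le_rfl hσ₂.2.le)).const_mul C₃
    have hnorm := intervalIntegral.norm_integral_le_of_norm_le hσ₂0.le
      (Eventually.of_forall fun τ hτ => hbound τ hτ) hPfI
    rw [← hid] at hnorm
    have hrhs : ∫ τ in (0 : ℝ)..σ₂, (CH + C₃ * Pf τ) ≤ CH * |s| + C₃ * ((K₀ * a ^ 2) ^ (2 / 3 : ℝ) * (|s| * VB) ^ (1 / 3 : ℝ)) := by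
      rw [intervalIntegral.integral_of_le hσ₂0.le, integral_Ioc_eq_integral_Ioo,
        integral_add (integrableOn_const (C := CH) measure_Ioo_lt_top.ne)
          ((hPfint.mono_set (Ioo_subset_Ioo le_rfl hσ₂.2.le)).const_mul C₃),
        setIntegral_const, integral_const_mul, Real.volume_real_Ioo_of_le hσ₂0.le, sub_zero, smul_eq_mul]
      have h1 : ∫ τ in Ioo 0 σ₂, Pf τ ≤ ∫ τ in Ioo 0 |s|, Pf τ :=
        setIntegral_mono_set hPfint (Eventually.of_forall hPfnn) (Eventually.of_forall (Ioo_subset_Ioo le_rfl hσ₂.2.le))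
      nlinarith [h1, hPftot, hσ₂.2, mul_comm σ₂ CH]
    have hsplit : (|s| * VB) ^ (1 / 3 : ℝ) = |s| ^ (1 / 3 : ℝ) * VB ^ (1 / 3 : ℝ) :=
      Real.mul_rpow hs0.le hVB0
    rw [Real.norm_eq_abs] at hnorm
    calc |g σ₂ - g 0| ≤ CH * |s| + C₃ * ((K₀ * a ^ 2) ^ (2 / 3 : ℝ) * (|s| * VB) ^ (1 / 3 : ℝ)) := hnorm.trans hrhs
      _ = CH * |s| + CP * |s| ^ (1 / 3 : ℝ) := by rw [hsplit]; simp only [hCP]; ring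
      _ ≤ (CH + CP) * (|s| + |s| ^ (1 / 3 : ℝ)) := by
          have : 0 ≤ |s| ^ (1 / 3 : ℝ) := by positivity
          nlinarith [hCH0, hCP0, hs0.le, this]
  -- Step B: let `σ₂ → |s|⁻` through the weak continuity of `u` at `T`
  set Φ : EuclideanSpace ℝ (Fin 3) → EuclideanSpace ℝ (Fin 3) := fun x => (R * (R ^ 3)⁻¹) • φ (R⁻¹ • (x - x₀))
    with hΦ
  have hφcont : Continuous φ := hφ.continuous
  have hΦc : Continuous Φ := by simp only [hΦ]; fun_prop
  have hΦs : HasCompactSupport Φ := by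
    set e : EuclideanSpace ℝ (Fin 3) ≃ₜ EuclideanSpace ℝ (Fin 3) :=
      (Homeomorph.addRight (-x₀)).trans (Homeomorph.smulOfNeZero R⁻¹ (inv_ne_zero hR.ne')) with he
    have h1 : (fun x => φ (R⁻¹ • (x - x₀))) = φ ∘ e := by
      funext x
      simp [he, Homeomorph.trans, sub_eq_add_neg]
    have h2 : HasCompactSupport fun x => φ (R⁻¹ • (x - x₀)) := by rw [h1]; exact hφc.comp_homeomorph e
    have h3 : Φ = (fun _ : EuclideanSpace ℝ (Fin 3) => R * (R ^ 3)⁻¹) • fun x => φ (R⁻¹ • (x - x₀)) := rfl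
    rw [h3]
    exact h2.smul_left
  have hΦmem : MemLp Φ 2 volume := hΦc.memLp_of_hasCompactSupport hΦs
  have hwcont : ContinuousOn (fun θ => ∫ x, ⟪u θ x, Φ x⟫) (Ioc 0 T) := (hLH.weak_continuous Φ hΦmem).1
  have hgeq : g = (fun θ => ∫ x, ⟪u θ x, Φ x⟫) ∘ fun σ => t + R ^ 2 * σ := by
    funext σ
    simp only [hg, Function.comp, hv_apply]
    exact integral_inner_space_zoom (u (t + R ^ 2 * σ)) φ x₀ hR
  have hgcont : ContinuousWithinAt g (Icc 0 |s|) |s| := by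
    rw [hgeq]
    refine ContinuousWithinAt.comp (t := Ioc 0 T) ?_ (by fun_prop) fun σ hσ => ?_
    · rw [htop]; exact hwcont T ⟨hT, le_rfl⟩
    · have h := htime σ hσ
      have h1 : 0 ≤ R ^ 2 * σ := mul_nonneg hR2.le hσ.1
      exact ⟨by show 0 < t + R ^ 2 * σ; linarith, h.2⟩
  have htend : Tendsto g (𝓝[<] |s|) (𝓝 (g |s|)) := by
    have h1 : Tendsto g (𝓝[Icc 0 |s|] |s|) (𝓝 (g |s|)) := hgcont
    rw [nhdsWithin_Icc_eq_nhdsLE hs0] at h1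
    exact h1.mono_left (nhdsWithin_mono _ Iio_subset_Iic_self)
  have hev : ∀ᶠ σ₂ in 𝓝[<] |s|, |g σ₂ - g 0| ≤ (CH + CP) * (|s| + |s| ^ (1 / 3 : ℝ)) := by
    filter_upwards [Ioo_mem_nhdsLT hs0] with σ₂ hσ₂ using hstepA σ₂ hσ₂
  have hlim := le_of_tendsto ((htend.sub_const (g 0)).abs) hev
  rw [← hg0, ← hgs, abs_sub_comm]
  exact hlim



end Summit.NavierStokesRegularity.NavierStokesRegularity.Theorems.TypeITraceScarL3

end
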